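import Summits.AtomisticToContinuum.Crystallization.Theorems.ChartedZeroExcessLayeredLatticeLiouvilleTQ
import Summits.AtomisticToContinuum.Crystallization.Theorems.ChartedZeroExcessLayeredLatticeLiouvilleUntwistBook

/-!
# Zero-excess layered lattice Liouville — part TR (lens-2 g41 node «TiltVersusStrain»): layer 2 beneath the residual (R_W) `WildFractionPG`

## The node (structural dichotomy: the SPECIAL rotational part of a registration vs its GENERIC strain part)
(R_W) `WildFractionPG aHi Λ θ s` (part TB; binder `hW` of the columns `_16XH16/17/18`, the column's DECLARED RESIDUAL since g32, tag of record
UNDECIDED in the hot-spot regime · SUPPORTED in the defect-free regime by census TAG 174 (a⁗)) asks, on FAT windows of θ-good GSC door sets, for a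
RE-registration whose `ϑ₀`-WILD MASS (`ϑ₀ = tameRadius = 1/20`; bonds of length `≤ 4` whose distortion AGAINST THE IDENTITY is `≥ ϑ₀`) is `≤ εw·η·nK`.
A `4`-bond is wild for one of two structurally different reasons: the local map at its base site is far from EVERY rigid motion (STRAIN / non-affinity),
or it is close to a rigid motion whose rotation is far from the identity (TILT).  The two halves obey different mathematics:
* ★★ (K) `TiltRigidityP` — the SPECIAL part: rotations are SLAVED to strain by compatibility.  Given ANY registered map `Ψ` and ANY tilt–strain data
  `(Q, σ)` for it (`IsTiltStrainData`: rotations `Q x ∈ SO(3)` and a profile `σ ≥ 0` dominating, at every window site, the misfit of every `4`-bond after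
  rotation by `Q x`), the cubed tilts are controlled by the cubed strains plus an `o(η)` remainder: `Σ_{win R} ‖Q x − 1‖³ ≤ C_K·Σ_{win R} σ³ + ε·η·nK`
  (`η ≤ η₁(ε)`).  ENERGY-FREE (door `IsDoorSetP`), KNOWN-type mechanism: the geometric-rigidity estimate of Friesecke–James–Müller in `L³` (exponent
  `p = 3`; any `p > 2` would do, `p = 2` would NOT — see the seam) for the piecewise-affine interpolant of `Ψ` on the window (`dist(∇u, SO(3)) ≲ σ`
  cellwise by the `4`-ball overlaps of θ-good sites), giving ONE rotation `Q̄` with `Σ‖Q x − Q̄‖³ ≤ C·Σσ³`, and the identification `‖Q̄ − 1‖ ≲ √(Cg·η) +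
  ‖σ‖_{3,avg}` from the registration's POSITION budget `Σ‖x − Ψ x‖² ≤ Cg·η·R²·nK` (a rotation `Q̄ ≠ 1` moves half of a fat round window by `≳ ‖Q̄ − 1‖·R/4`)
  — whence the remainder `C·(Cg·η)^{3/2}·nK ≤ ε·η·nK`.  It is the `L³`, rotation-FIELD form of hand-1's `L²` piece `CleanWindowRigidityP` (part
  RigidityPiece; global `Q`, length defect): same cell lemma + continuum estimate, different exponent and read-out.
* ★★ (M) `StrainNonConcentrationPG` — the GENERIC part: on fat windows of θ-good GSC door sets a RE-registration `Ψ'` (constant `Cg' ≥ Cg`, as in (R_W))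
  admits tilt–strain data whose strain is `o(η)` IN `L³`: `Σ_{win R} σ³ ≤ ε·η·nK` for `η ≤ η₁(ε, K₀)`, `R ≥ R₁(ε, K₀)`.  GSC-PRICED (door `IsDoorSetPG`),
  UNDECIDED, TRUE-type expected in the defect-free regime (TAG 174 (a⁗): after relaxation even the misfit against the identity is `< 1/20` on every
  interior bond), sharing (R_W)'s open hot-spot scenario; IDEA-NAMED: Meyers–Gehring HIGHER INTEGRABILITY of the strain of μ-equilibria — a reverse
  Hölder inequality for `σ` (Caccioppoli MODULO RIGID MOTIONS against the same-word equilibrium chart of (B1), then Gehring's lemma) gives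
  `(avg σ^p)^{1/p} ≤ C·(avg τ²)^{1/2} ≤ C·√(Cg·η)` for some `p > 2`, and since `σ ≤ 12` w.l.o.g., `Σσ³ ≤ 12^{3−p}·C·η^{p/2}·nK = o(η)·nK`.  Tilt-BLIND
  (local rotations are free) but demanded at EVERY strain threshold — transverse to (R_W), which is tilt-sensitive at the one threshold `ϑ₀`.
* ★★★ the seam `wildFractionPG_of_tilt_strain` : (K) ∧ (M) ⇒ (R_W) (PROVED, `Ψ' :=` (M)'s re-registration): a `ϑ₀`-wild bond at `x` forces
  `σ x ≥ ϑ₀/2 ∨ ‖Q x − 1‖ ≥ ϑ₀/8` (`dist(p−x, Ψ'p−Ψ'x) ≤ 4·‖Q x − 1‖ + σ x`); a site carries at most `N₄ = (8/δ+1)³` bonds of length `≤ 4`, each of squared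
  distortion `≤ 144` (tear-free `4 ↦ 8`); the indicator of a bad site is `≤ (2σ x/ϑ₀)³ + (8‖Q x − 1‖/ϑ₀)³`; so `wildMass ϑ₀ ≤ 144·N₄·((2/ϑ₀)³·Σσ³ +
  (8/ϑ₀)³·Σ‖Q x − 1‖³) ≤ 144·N₄·((2/ϑ₀)³ + (8/ϑ₀)³·C_K)·Σσ³ + 144·N₄·(8/ϑ₀)³·ε_K·η·nK ≤ εw·η·nK` with `ε_K := εw/(2B)`, `ε_M := εw/(2(A + B·C_K))`.
  WHY CUBES: with squares only, Chebyshev from the registration budget `Στ² ≤ Cg·η·nK` bounds the wild SET by `400·Cg·η·nK` sites, which may carry wild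
  MASS `≍ Cg·η·nK ≫ εw·η·nK` (critic row 581); an exponent `> 2` on BOTH halves is exactly what makes the count `o(η)`.
Neither piece is implied by (R_W) nor implies it alone ((M) ignores tilt; (K) says nothing about strain); the cut moves the whole difficulty of (R_W) into
ONE literature-shaped estimate — higher integrability of equilibrium strain — and discharges the rotational half by a known-type rigidity theorem.
Columns `_16XH19_tol` / `_16XH19` (ν := 1/2000): `_16XH18` with the leaf (R_W) replaced by (K) ∧ (M) and the leaf (Υb) `UntwistBookkeepingP 1 2 (1/50)`
DISCHARGED by hand-1's `untwistBookkeepingP_one` (part UntwistBook, p841020) — 23 opaque leaves.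
0 EQUIV; placeholder-free; no type-class declarations, custom syntax or option pragmas.
-/

noncomputable section

open scoped BigOperators InnerProductSpace RealInnerProductSpace
open MeasureTheory Set Metric Filter Topology
open Summit.AtomisticToContinuum.Crystallization.Theorems.ChartedPlanarOrderRigidityDoor
  (E3 IsClean IsNash IsCharted IsEStarGSC VisibleGap PertRegime atomsIn siteEnergy eStar BindingSurface)
open Summit.AtomisticToContinuum.Crystallization.Theorems.ChartedPlanarOrderDensityDichotomy (μS IsSep nK nK_nonneg excess)
open Summit.AtomisticToContinuum.Crystallization.Theorems.ChartedPlanarOrderMesoCut (IsDoorSet NearHom LayeredHom layerOf EnvClose)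
open Summit.AtomisticToContinuum.Crystallization.Theorems.ChartedPlanarOrderDoorLayered
  (TwoPeriodic DoorPeriodic PeriodicBulkGapDoor NearHomL2BD Layered atomsIn_subset)
open Summit.AtomisticToContinuum.Crystallization.Theorems.ChartedPlanarOrderDoorLayeredOsc (IsTwoShellAffineGood DoorPeriodicOsc)
open Summit.AtomisticToContinuum.Crystallization.Theorems.ChartedPlanarOrderCleanScaleP (IsCleanP IsDoorSetP DoorPeriodicP isDoorSetP_one_iff)
open Literature.MathematicalPhysics.StatisticalMechanics (lennardJones IsHaggSeq triangularVec₁ triangularVec₂ card_le_of_separated_of_dist_le)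

namespace Summit.AtomisticToContinuum.Crystallization.Theorems.ChartedZeroExcessLayeredLatticeLiouville

/-! ### XIX.1  The currency: tilt–strain data of a map on a window -/

/-- the **tilt** of a linear isometry `U` of `E3`: its operator-norm distance to the identity, `‖U − 1‖`. [this file, g41] -/
def tilt (U : E3 ≃ₗᵢ[ℝ] E3) : ℝ := ‖(U.toContinuousLinearEquiv : E3 →L[ℝ] E3) - ContinuousLinearMap.id ℝ E3‖

/-- the tilt is nonnegative. [this file, g41] -/
theorem tilt_nonneg (U : E3 ≃ₗᵢ[ℝ] E3) : 0 ≤ tilt U := norm_nonneg _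

/-- a vector moves under `U` by at most `tilt U · ‖v‖`. [this file, g41] -/
theorem dist_map_le_tilt (U : E3 ≃ₗᵢ[ℝ] E3) (v : E3) : dist v (U v) ≤ tilt U * ‖v‖ := by
  have h := ((U.toContinuousLinearEquiv : E3 →L[ℝ] E3) - ContinuousLinearMap.id ℝ E3).le_opNorm v
  have h2 : ((U.toContinuousLinearEquiv : E3 →L[ℝ] E3) - ContinuousLinearMap.id ℝ E3) v = U v - v := by simp
  rw [h2] at h
  rw [dist_comm, dist_eq_norm]
  exact h

/-- ★ **tilt–strain data `(Q, σ)` for a map `Ψ` on the window `win R = atomsIn (μS S) 0 R`**: a field of ROTATIONS `Q x` (linear isometries of `E3` of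
determinant `1`) and a nonnegative STRAIN profile `σ` such that at every window site `x` EVERY `4`-bond `p − x` (`p ∈ S`, `dist p x ≤ 4`, also `p` outside
the window), once rotated by `Q x`, matches the image bond `Ψ p − Ψ x` within `σ x`.  So `σ x` is the misfit at scale `4` of the local map at `x` to the
rigid motion `v ↦ Ψ x + Q x v` (strain and non-affinity together) and `tilt (Q x)` is its rotational part measured against the identity; the data with
`Q ≡ 1`, `σ :=` the registration profile at level `D = R + 4` always exist — the content of the pieces below is in the SIZE of `σ`. [this file, g41] -/
def IsTiltStrainData (S : Set E3) (R : ℝ) (Ψ : E3 → E3) (Q : E3 → (E3 ≃ₗᵢ[ℝ] E3)) (σ : E3 → ℝ) : Prop :=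
  (∀ x : E3, LinearMap.det ((Q x).toLinearEquiv : E3 →ₗ[ℝ] E3) = 1) ∧ (∀ x : E3, 0 ≤ σ x) ∧
    ∀ x ∈ atomsIn (μS S) 0 R, ∀ p ∈ S, dist p x ≤ 4 → dist ((Q x) (p - x)) (Ψ p - Ψ x) ≤ σ x

/-! ### XIX.2  The two pieces beneath (R_W) -/

/-- ★★ **(K) «TiltRigidityP aHi Λ θ s»** — ROTATIONS ARE SLAVED TO STRAIN (the SPECIAL, rigid part; ENERGY-FREE by type: door `IsDoorSetP`).  For every
`δ, a, Cg` there is `C_K ≥ 1`, and for every `ε > 0` a ceiling `η₁` and a floor `R₁`, such that for every θ-good `aHi`-door set, every level `η ≤ η₁`,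
radius `R ≥ R₁`, equilibrium `s`-chart `(L, w)`, every map `Ψ` with `IsGlobalReg Cg η R S (LayeredHom L w) Ψ` and EVERY tilt–strain data `(Q, σ)` of `Ψ` on
`win R`: `Σ_{win R} tilt(Q x)³ ≤ C_K·Σ_{win R} σ x³ + ε·η·nK(win R)`.  Mechanism (KNOWN-type): the Friesecke–James–Müller rigidity estimate in `L³`
(dilation-invariant constant on balls) for the piecewise-affine interpolant of `Ψ`, whose gradient is cellwise `≲ σ`-close to the rotation field by the
overlap of the `4`-balls of θ-good sites — ONE rotation `Q̄` with `Σ‖Q x − Q̄‖³ ≤ C·Σσ³` — and `‖Q̄ − 1‖ ≲ √(Cg·η) + ‖σ‖_{3,avg}` from the position budget of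
the registration (Poincaré on the window + a rotation `≠ 1` displaces half of a fat round window by `≳ ‖Q̄ − 1‖·R/4`), so the identification costs
`C·(Cg·η)^{3/2}·nK ≤ ε·η·nK` once `η ≤ η₁(ε)`.  The `L³`/rotation-field sibling of `CleanWindowRigidityP` (part RigidityPiece, `L²`, length defect, global
`Q`).  SPECIAL STRUCTURE (compatibility) · ENERGY-FREE · TRUE-type expected · ATTACKABLE·L (interpolation on θ-good windows + the continuum estimate, the
latter a citation until typed).
Why it might fail: only through the typing — sites whose `4`-neighbourhood does not determine a rotation (excluded: θ-good two-shell environments are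
well-conditioned frames), or orientation flips (excluded: `det Q x = 1`, and a registered bijection cannot fold: tear-free `4 ↦ 8` both ways + position
budget); the continuum estimate itself holds for every exponent `1 < p < ∞`.
Sources: Friesecke–James–Müller, Comm. Pure Appl. Math. 55 (2002) Thm 3.1; Conti–Schweizer, Comm. Pure Appl. Math. 59 (2006) §2 (the `L^p` form);
Flatley–Theil, Arch. Ration. Mech. Anal. 218 (2015), arXiv 1407.0692, Thm 4.1 / Prop 4.2 (discrete fcc form); Schmidt, Netw. Heterog. Media 4 (2009) 789
(discrete rigidity via interpolation); [kruzik2019 Thm 1.1.12]; this tree: `CleanWindowRigidityP`. [this file, g41] -/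
def TiltRigidityP (aHi Λ θ s : ℝ) : Prop :=
  ∀ δ : ℝ, 0 < δ → ∀ a : ℝ, 0 < a → ∀ Cg : ℝ, 1 ≤ Cg → ∃ CK : ℝ, 1 ≤ CK ∧
    ∀ ε : ℝ, 0 < ε → ∃ η₁ : ℝ, 0 < η₁ ∧ ∃ R₁ : ℝ, 0 < R₁ ∧
      ∀ S : Set E3, IsDoorSetP aHi δ S → (∀ q ∈ S, IsTwoShellAffineGood θ S q) →
        ∀ η : ℝ, 0 < η → η ≤ η₁ → ∀ R : ℝ, R₁ ≤ R →
          ∀ (L : E3 ≃L[ℝ] E3) (w : ℤ → E3), IsEquilChart a s Λ L w →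
            ∀ Ψ : E3 → E3, IsGlobalReg Cg η R S (LayeredHom (L : E3 →L[ℝ] E3) w) Ψ →
              ∀ (Q : E3 → (E3 ≃ₗᵢ[ℝ] E3)) (σ : E3 → ℝ), IsTiltStrainData S R Ψ Q σ →
                ∑ᶠ x ∈ atomsIn (μS S) 0 R, tilt (Q x) ^ 3 ≤
                  CK * ∑ᶠ x ∈ atomsIn (μS S) 0 R, σ x ^ 3 + ε * η * nK (atomsIn (μS S) 0 R)

/-- ★★ **(M) «StrainNonConcentrationPG aHi Λ θ s»** — THE STRAIN OF A RE-REGISTRATION IS `o(η)` IN `L³` (the GENERIC part; GSC-PRICED: door `IsDoorSetPG`).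
With (R_W)'s binder prefix (`∀ δ a Cg ∃ Cg' ≥ Cg`, then `∀ ε K₀ ∃ η₁ R₁`): on every FAT window (`K₀ ≤ η·nK(win R)`) of a θ-good GSC door set registered by
`Ψ` at `(Cg, η, R)` to an equilibrium `s`-chart, there are a RE-registration `Ψ'` at `(Cg', η, R)` to the same chart and tilt–strain data `(Q, σ)` for `Ψ'`
with `Σ_{win R} σ x³ ≤ ε·η·nK(win R)`.  Tilt-BLIND (the local rotations `Q x` are free), but at EVERY strain size: transverse to (R_W) (which is
tilt-sensitive at the single threshold `ϑ₀`); with (K) it implies (R_W) (`wildFractionPG_of_tilt_strain`, PROVED).  The re-registration freedom is (R_W)'s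
own and is necessary: a given registration may be gratuitously non-rigid on a set of density `≍ Cg·η` at no extra cost in `Στ²`.
Mechanism (IDEA-NAMED, UNDECIDED): HIGHER INTEGRABILITY of the strain of μ-equilibria (Meyers / Gehring): a reverse Hölder inequality for the local
rigid-motion misfit — Caccioppoli MODULO RIGID MOTIONS on every ball (testing the GSC inequality with rigidly re-fitted patches of the same-word
equilibrium chart of (B1), NOT the naive «site excess ≍ strain²», which the word floor `ε_w ≈ 9·10⁻⁵` forbids), then Gehring's lemma: `(avg_{win R} σ^p)^{1/p}
≤ C·(avg_{win 2R} τ²)^{1/2} ≤ C·√(2Cg·η)` for some `p > 2`; as `σ ≤ 12` w.l.o.g., `Σσ³ ≤ 12^{3−p}·C^p·(2Cg·η)^{p/2}·nK ≤ ε·η·nK` for `η ≤ η₁(ε)`.  The stronger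
ε-regularity / interior Lipschitz route (Evans-type) would give `σ ≲ √η` pointwise off an `o(η)` set.  GENERIC · GSC-priced · UNDECIDED · TRUE-type
expected in the defect-free regime (census TAG 174 (a⁗): on 54/54 relaxed interior windows even the misfit against the identity is `< 1/20` on every
bond) · L.
Why it might fail: HOT SPOTS — θ-good, e⋆-GSC-compatible localised distortion sources at spatial density `≍ η`, each of registration cost `O(1)`,
would saturate Chebyshev and pin `Σσ³ ≍ η·nK` (the same open scenario as (R_W); census instrument M18 wanted); and the reverse Hölder step needs the
comparison patches to stay inside the door class (clean, single-site Nash), i.e. a basin `η ≤ η₁` small enough.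
Sources: Meyers, Ann. Sc. Norm. Sup. Pisa 17 (1963) 189; Gehring, Acta Math. 130 (1973) 265; Giaquinta–Modica, J. reine angew. Math. 311/312 (1979) 145;
[giaquinta1984 ch. V]; Evans, Arch. Ration. Mech. Anal. 95 (1986) 227 (ε-regularity); E–Ming, Arch. Ration. Mech. Anal. 183 (2007) (Cauchy–Born
stability); this tree: `WildFractionPG`, `WildReRegistrationPG`, census TAG 174 (a⁗). [this file, g41] -/
def StrainNonConcentrationPG (aHi Λ θ s : ℝ) : Prop :=
  ∀ δ : ℝ, 0 < δ → ∀ a : ℝ, 0 < a → ∀ Cg : ℝ, 1 ≤ Cg → ∃ Cg' : ℝ, Cg ≤ Cg' ∧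
    ∀ ε : ℝ, 0 < ε → ∀ K₀ : ℝ, 0 < K₀ → ∃ η₁ : ℝ, 0 < η₁ ∧ ∃ R₁ : ℝ, 0 < R₁ ∧
      ∀ S : Set E3, IsDoorSetPG aHi δ S → (∀ q ∈ S, IsTwoShellAffineGood θ S q) →
        ∀ η : ℝ, 0 < η → η ≤ η₁ → ∀ R : ℝ, R₁ ≤ R →
          ∀ (L : E3 ≃L[ℝ] E3) (w : ℤ → E3), IsEquilChart a s Λ L w →
            ∀ Ψ : E3 → E3, IsGlobalReg Cg η R S (LayeredHom (L : E3 →L[ℝ] E3) w) Ψ →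
              K₀ ≤ η * nK (atomsIn (μS S) 0 R) →
                ∃ Ψ' : E3 → E3, IsGlobalReg Cg' η R S (LayeredHom (L : E3 →L[ℝ] E3) w) Ψ' ∧
                  ∃ (Q : E3 → (E3 ≃ₗᵢ[ℝ] E3)) (σ : E3 → ℝ), IsTiltStrainData S R Ψ' Q σ ∧
                    ∑ᶠ x ∈ atomsIn (μS S) 0 R, σ x ^ 3 ≤ ε * η * nK (atomsIn (μS S) 0 R)

/-! ### XIX.3  The seam: (K) ∧ (M) ⇒ (R_W) (PROVED) -/

/-- packing: a `δ`-separated set has at most `(8/δ + 1)³` points in a closed `4`-ball meeting a finite window. [this file, g41] -/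
theorem ncard_window_inter_closedBall_four_le {δ : ℝ} (hδ : 0 < δ) {S W : Set E3} (hsep : IsSep δ S) (hWS : W ⊆ S) (hW : W.Finite) (x : E3) :
    ((W ∩ closedBall x 4).ncard : ℝ) ≤ (2 * 4 / δ + 1) ^ 3 := by
  have hfin : (W ∩ closedBall x 4).Finite := hW.inter_of_left _
  rw [Set.ncard_eq_toFinset_card _ hfin]
  have h1 := card_le_of_separated_of_dist_le hfin.toFinset x hδ (by norm_num : (0 : ℝ) ≤ 4)
    (fun c hc => mem_closedBall.1 ((hfin.mem_toFinset).1 hc).2)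
    (fun c hc d hd hcd => hsep c (hWS ((hfin.mem_toFinset).1 hc).1) d (hWS ((hfin.mem_toFinset).1 hd).1) hcd)
  have h3 : Module.finrank ℝ E3 = 3 := finrank_euclideanSpace_fin
  rwa [h3] at h1

/-- ★ **wild mass against tilt–strain data (PROVED)**: for a tear-free (`4 ↦ 8`) map `Ψ` on `S` with tilt–strain data `(Q, σ)` on `win R`, a `ϑ`-wild bond
at `x` forces `σ x ≥ ϑ/2 ∨ tilt (Q x) ≥ ϑ/8`, each site carries `≤ (8/δ+1)³` bonds of squared distortion `≤ 144`, and the bad-site indicator is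
`≤ (2σ x/ϑ)³ + (8·tilt(Q x)/ϑ)³`; hence `wildMass ϑ (win R) Ψ ≤ 144·(8/δ+1)³·((2/ϑ)³·Σσ³ + (8/ϑ)³·Σ tilt³)`. [this file, g41] -/
theorem wildMass_le_of_tiltStrainData {δ ϑ : ℝ} (hδ : 0 < δ) (hϑ : 0 < ϑ) {S : Set E3} (hsep : IsSep δ S) {R : ℝ} {Ψ : E3 → E3}
    (htear : ∀ x ∈ S, ∀ p ∈ S, dist p x ≤ 4 → dist (Ψ p) (Ψ x) ≤ 8) {Q : E3 → (E3 ≃ₗᵢ[ℝ] E3)} {σ : E3 → ℝ}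
    (hd : IsTiltStrainData S R Ψ Q σ) :
    wildMass ϑ (atomsIn (μS S) 0 R) Ψ ≤
      144 * (2 * 4 / δ + 1) ^ 3 * ((2 / ϑ) ^ 3 * ∑ᶠ x ∈ atomsIn (μS S) 0 R, σ x ^ 3 +
        (8 / ϑ) ^ 3 * ∑ᶠ x ∈ atomsIn (μS S) 0 R, tilt (Q x) ^ 3) := by
  set W := atomsIn (μS S) 0 R with hWdef
  have hWfin : W.Finite := finite_atomsIn hδ hsep R
  have hWS : W ⊆ S := fun y hy => (mem_atomsIn_iff.1 hy).1
  obtain ⟨-, hσ0, hdom⟩ := hd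
  have hN₄ : (0 : ℝ) ≤ 144 * (2 * 4 / δ + 1) ^ 3 := by positivity
  -- pointwise bound on the inner sums
  have hinner : ∀ x ∈ W,
      ∑ᶠ p ∈ W ∩ closedBall x 4, (if ϑ ≤ dist (p - x) (Ψ p - Ψ x) then dist (p - x) (Ψ p - Ψ x) ^ 2 else 0) ≤
        144 * (2 * 4 / δ + 1) ^ 3 * ((2 / ϑ) ^ 3 * σ x ^ 3 + (8 / ϑ) ^ 3 * tilt (Q x) ^ 3) := by
    intro x hx
    have hxS : x ∈ S := hWS hx
    have hfin : (W ∩ closedBall x 4).Finite := hWfin.inter_of_left _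
    have hσx : 0 ≤ σ x := hσ0 x
    have htx : 0 ≤ tilt (Q x) := tilt_nonneg (Q x)
    have hb0 : 0 ≤ (2 / ϑ) ^ 3 * σ x ^ 3 + (8 / ϑ) ^ 3 * tilt (Q x) ^ 3 := by positivity
    by_cases hgood : σ x < ϑ / 2 ∧ tilt (Q x) < ϑ / 8
    · -- a good site carries no wild bond
      have h0 : ∑ᶠ p ∈ W ∩ closedBall x 4,
          (if ϑ ≤ dist (p - x) (Ψ p - Ψ x) then dist (p - x) (Ψ p - Ψ x) ^ 2 else 0) = 0 := by
        refine finsum_mem_of_eqOn_zero fun p hp => ?_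
        have hpS : p ∈ S := hWS hp.1
        have hpx : dist p x ≤ 4 := mem_closedBall.1 hp.2
        have hpx' : ‖p - x‖ ≤ 4 := by rwa [← dist_eq_norm]
        have h1 : dist (p - x) (Ψ p - Ψ x) < ϑ :=
          calc dist (p - x) (Ψ p - Ψ x) ≤ dist (p - x) ((Q x) (p - x)) + dist ((Q x) (p - x)) (Ψ p - Ψ x) := dist_triangle _ _ _
            _ ≤ tilt (Q x) * 4 + σ x :=
                add_le_add ((dist_map_le_tilt (Q x) (p - x)).trans (mul_le_mul_of_nonneg_left hpx' htx)) (hdom x hx p hpS hpx)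
            _ < ϑ / 8 * 4 + ϑ / 2 := add_lt_add (mul_lt_mul_of_pos_right hgood.2 (by norm_num)) hgood.1
            _ = ϑ := by ring
        show (if ϑ ≤ dist (p - x) (Ψ p - Ψ x) then dist (p - x) (Ψ p - Ψ x) ^ 2 else 0) = 0
        rw [if_neg (not_le.2 h1)]
      rw [h0]
      exact mul_nonneg hN₄ hb0
    · -- a bad site: each of its `≤ (8/δ+1)³` bonds has squared distortion `≤ 144`, and its indicator is `≤` the cubic expression
      have hterm : ∀ p ∈ W ∩ closedBall x 4,
          (if ϑ ≤ dist (p - x) (Ψ p - Ψ x) then dist (p - x) (Ψ p - Ψ x) ^ 2 else 0) ≤ (144 : ℝ) := by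
        intro p hp
        have hpS : p ∈ S := hWS hp.1
        have hpx : dist p x ≤ 4 := mem_closedBall.1 hp.2
        have hd12 : dist (p - x) (Ψ p - Ψ x) ≤ 12 := by
          rw [dist_eq_norm]
          calc ‖p - x - (Ψ p - Ψ x)‖ ≤ ‖p - x‖ + ‖Ψ p - Ψ x‖ := norm_sub_le _ _
            _ ≤ 4 + 8 := add_le_add (by rwa [← dist_eq_norm]) (by rw [← dist_eq_norm]; exact htear x hxS p hpS hpx)
            _ = 12 := by norm_num
        have hd0 : 0 ≤ dist (p - x) (Ψ p - Ψ x) := dist_nonneg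
        split_ifs
        · nlinarith
        · norm_num
      have hsum : ∑ᶠ p ∈ W ∩ closedBall x 4,
          (if ϑ ≤ dist (p - x) (Ψ p - Ψ x) then dist (p - x) (Ψ p - Ψ x) ^ 2 else 0) ≤ ∑ᶠ _p ∈ W ∩ closedBall x 4, (144 : ℝ) := by
        rw [finsum_mem_eq_finite_toFinset_sum _ hfin, finsum_mem_eq_finite_toFinset_sum _ hfin]
        exact Finset.sum_le_sum fun p hp => hterm p (hfin.mem_toFinset.1 hp)
      have hcount : ∑ᶠ _p ∈ W ∩ closedBall x 4, (144 : ℝ) = 144 * ((W ∩ closedBall x 4).ncard : ℝ) := by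
        rw [finsum_mem_eq_finite_toFinset_sum _ hfin, Finset.sum_const, nsmul_eq_mul, Set.ncard_eq_toFinset_card _ hfin, mul_comm]
      have hN : ((W ∩ closedBall x 4).ncard : ℝ) ≤ (2 * 4 / δ + 1) ^ 3 := ncard_window_inter_closedBall_four_le hδ hsep hWS hWfin x
      have hb : 1 ≤ (2 / ϑ) ^ 3 * σ x ^ 3 + (8 / ϑ) ^ 3 * tilt (Q x) ^ 3 := by
        rcases not_and_or.1 hgood with h | h
        · have h1 : 1 ≤ 2 / ϑ * σ x := by
            rw [div_mul_eq_mul_div, le_div_iff₀ hϑ]; linarith [not_lt.1 h]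
          have h2 : 1 ≤ (2 / ϑ) ^ 3 * σ x ^ 3 := by rw [← mul_pow]; exact one_le_pow₀ h1
          have h3 : 0 ≤ (8 / ϑ) ^ 3 * tilt (Q x) ^ 3 := by positivity
          linarith
        · have h1 : 1 ≤ 8 / ϑ * tilt (Q x) := by
            rw [div_mul_eq_mul_div, le_div_iff₀ hϑ]; linarith [not_lt.1 h]
          have h2 : 1 ≤ (8 / ϑ) ^ 3 * tilt (Q x) ^ 3 := by rw [← mul_pow]; exact one_le_pow₀ h1
          have h3 : 0 ≤ (2 / ϑ) ^ 3 * σ x ^ 3 := by positivity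
          linarith
      calc ∑ᶠ p ∈ W ∩ closedBall x 4, (if ϑ ≤ dist (p - x) (Ψ p - Ψ x) then dist (p - x) (Ψ p - Ψ x) ^ 2 else 0)
          ≤ 144 * ((W ∩ closedBall x 4).ncard : ℝ) := hsum.trans_eq hcount
        _ ≤ 144 * (2 * 4 / δ + 1) ^ 3 * 1 := by rw [mul_one]; exact mul_le_mul_of_nonneg_left hN (by norm_num)
        _ ≤ 144 * (2 * 4 / δ + 1) ^ 3 * ((2 / ϑ) ^ 3 * σ x ^ 3 + (8 / ϑ) ^ 3 * tilt (Q x) ^ 3) := mul_le_mul_of_nonneg_left hb hN₄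
  -- sum over the window
  have hfs := finsum_mem_eq_finite_toFinset_sum (fun x => σ x ^ 3) hWfin
  have hft := finsum_mem_eq_finite_toFinset_sum (fun x => tilt (Q x) ^ 3) hWfin
  rw [wildMass, finsum_mem_eq_finite_toFinset_sum _ hWfin, hfs, hft, Finset.mul_sum, Finset.mul_sum, ← Finset.sum_add_distrib, Finset.mul_sum]
  exact Finset.sum_le_sum fun x hx => hinner x (hWfin.mem_toFinset.1 hx)

/-- ★★★ **THE SEAM (PROVED): (K) `TiltRigidityP` ∧ (M) `StrainNonConcentrationPG` ⇒ (R_W) `WildFractionPG`.**  Constants: `Cg' :=` (M)'s; given `εw`,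
with `A := 144·(8/δ+1)³·(2/ϑ₀)³`, `B := 144·(8/δ+1)³·(8/ϑ₀)³` and (K)'s `C_K` at `Cg'`: `ε_K := εw/(2B)`, `ε_M := εw/(2(A + B·C_K))`; `η₁ := min`, `R₁ := max`
of the two pieces' thresholds; `Ψ' :=` (M)'s re-registration; then `wildMass ϑ₀ ≤ A·Σσ³ + B·Σtilt³ ≤ (A + B·C_K)·Σσ³ + B·ε_K·η·nK ≤ εw·η·nK`. [this file, g41] -/
theorem wildFractionPG_of_tilt_strain {aHi Λ θ s : ℝ} (hK : TiltRigidityP aHi Λ θ s) (hM : StrainNonConcentrationPG aHi Λ θ s) :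
    WildFractionPG aHi Λ θ s := by
  intro δ hδ a ha Cg hCg
  obtain ⟨Cg', hCgCg', hM1⟩ := hM δ hδ a ha Cg hCg
  obtain ⟨CK, hCK, hK1⟩ := hK δ hδ a ha Cg' (hCg.trans hCgCg')
  refine ⟨Cg', hCgCg', fun εw hεw K₀ hK₀ => ?_⟩
  -- the constants of the seam
  obtain ⟨A, hAdef⟩ : ∃ A : ℝ, A = 144 * (2 * 4 / δ + 1) ^ 3 * (2 / tameRadius) ^ 3 := ⟨_, rfl⟩
  obtain ⟨B, hBdef⟩ : ∃ B : ℝ, B = 144 * (2 * 4 / δ + 1) ^ 3 * (8 / tameRadius) ^ 3 := ⟨_, rfl⟩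
  have hϑ := tameRadius_pos
  have hApos : 0 < A := by rw [hAdef]; positivity
  have hBpos : 0 < B := by rw [hBdef]; positivity
  have hABpos : 0 < A + B * CK := add_pos_of_pos_of_nonneg hApos (mul_nonneg hBpos.le (zero_le_one.trans hCK))
  have hBne : B ≠ 0 := hBpos.ne'
  have hABne : A + B * CK ≠ 0 := hABpos.ne'
  obtain ⟨ηK, hηK, RK, hRK, hK2⟩ := hK1 (εw / (2 * B)) (by positivity)
  obtain ⟨ηM, hηM, RM, hRM, hM2⟩ := hM1 (εw / (2 * (A + B * CK))) (by positivity) K₀ hK₀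
  refine ⟨min ηK ηM, lt_min hηK hηM, max RK RM, lt_max_of_lt_left hRK, ?_⟩
  intro S hS hgood η hη hηle R hR L w hLw Ψ hΨ hfat
  obtain ⟨Ψ', hΨ', Q, σ, hdata, hσ3⟩ :=
    hM2 S hS hgood η hη (hηle.trans (min_le_right _ _)) R ((le_max_right _ _).trans hR) L w hLw Ψ hΨ hfat
  have htilt := hK2 S hS.isDoorSetP hgood η hη (hηle.trans (min_le_left _ _)) R ((le_max_left _ _).trans hR) L w hLw Ψ' hΨ' Q σ hdata
  refine ⟨Ψ', hΨ', ?_⟩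
  have hsep : IsSep δ S := hS.1.2.1
  have hmass := wildMass_le_of_tiltStrainData hδ hϑ hsep hΨ'.2.1 hdata
  calc wildMass tameRadius (atomsIn (μS S) 0 R) Ψ'
      ≤ 144 * (2 * 4 / δ + 1) ^ 3 * ((2 / tameRadius) ^ 3 * ∑ᶠ x ∈ atomsIn (μS S) 0 R, σ x ^ 3 +
          (8 / tameRadius) ^ 3 * ∑ᶠ x ∈ atomsIn (μS S) 0 R, tilt (Q x) ^ 3) := hmass
    _ = A * ∑ᶠ x ∈ atomsIn (μS S) 0 R, σ x ^ 3 + B * ∑ᶠ x ∈ atomsIn (μS S) 0 R, tilt (Q x) ^ 3 := by rw [hAdef, hBdef]; ring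
    _ ≤ A * ∑ᶠ x ∈ atomsIn (μS S) 0 R, σ x ^ 3 +
          B * (CK * ∑ᶠ x ∈ atomsIn (μS S) 0 R, σ x ^ 3 + εw / (2 * B) * η * nK (atomsIn (μS S) 0 R)) :=
        add_le_add le_rfl (mul_le_mul_of_nonneg_left htilt hBpos.le)
    _ = (A + B * CK) * ∑ᶠ x ∈ atomsIn (μS S) 0 R, σ x ^ 3 + εw / 2 * (η * nK (atomsIn (μS S) 0 R)) := by
        field_simp
        ring
    _ ≤ (A + B * CK) * (εw / (2 * (A + B * CK)) * η * nK (atomsIn (μS S) 0 R)) + εw / 2 * (η * nK (atomsIn (μS S) 0 R)) :=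
        add_le_add (mul_le_mul_of_nonneg_left hσ3 hABpos.le) le_rfl
    _ = εw * η * nK (atomsIn (μS S) 0 R) := by
        field_simp
        ring

/-! ### XIX.4  The columns `_16XH19_tol` (ν generic), `_16XH19` (ν := 1/2000) -/

/-- ★★★ **COLUMN `_16XH19_tol` — TWENTY-THREE opaque leaves at a generic energy tolerance `ν`**: `_16XH18_tol` with the residual (R_W) `WildFractionPG`
replaced by (K) `TiltRigidityP` ∧ (M) `StrainNonConcentrationPG` (seam `wildFractionPG_of_tilt_strain`) and the leaf (Υb) `UntwistBookkeepingP 1 2 (1/50)`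
discharged by `untwistBookkeepingP_one` (part UntwistBook, PROVED): `LatticeLiouvilleCert → LayeredLiouvilleCert → R_G → X → Z_E(1/100) → P(1/100) → T →
U♮ᴱ(ν) → B1(1/100) → G♯ˣ → Λ₀ → Λ↑ → Υc → A0♯⁺ → N♮(ν) → FF → E → A⁰ᴱ(ν) → D⁰ᴱ(ν) → C♭ᴱ(ν) → K → M → PeriodicBulkGapDoor 2 → VisibleGap (1/50) ∧
PertRegime (1/50)`. [this file, g41] -/
theorem gap_and_pert_1_50_of_certs_16XH19_tol {ν : ℝ} (hL : LatticeLiouvilleCert) (hL' : LayeredLiouvilleCert)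
    (hR : OscRigidityL2BDPG 1 2 (1 / 16) (1 / 16)) (hX : ExcessFlatnessControlP 1 2 (1 / 16) (1 / 16))
    (hE : ExcessChartLocalisationP 1 2 (1 / 16) (1 / 100)) (hP : RegistrationP 1 2 (1 / 16) (1 / 100))
    (hT : TailDominationCert) (hU : UniformTameStabilityE (1 / 50) 2 ν)
    (h1 : WordTransplantP 1 2 (1 / 16) (1 / 100)) (hGT : GradReframingThickP 1 2 (1 / 16) (1 / 100) (1 / 50))
    (hΛ0 : LaunderingAprioriPX 1 2 (1 / 16) (1 / 100) (1 / 50)) (hΛs : LaunderingStepPX 1 2 (1 / 16) (1 / 100) (1 / 50))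
    (hUc : UntwistCollarP 1 2 (1 / 16) (1 / 50))
    (hl : BondIsoLevelsP 1 2 (1 / 16) (1 / 50)) (hN : EnergyNearChartPX 1 2 (1 / 16) (1 / 50) ν)
    (hF : TailForceSlavingP 1 2 (1 / 16) (1 / 50))
    (hE' : LipDualLinearisationP 1 2 (1 / 16) (1 / 50)) (hA : L2HarmonicApproxPE 1 2 (1 / 16) (1 / 50) ν)
    (hD : PositionDecayPLE 1 2 (1 / 16) (1 / 50) ν) (hC : PositionCaccioppoliPGE 1 2 (1 / 16) (1 / 50) ν)
    (hKt : TiltRigidityP 1 2 (1 / 16) (1 / 50)) (hM : StrainNonConcentrationPG 1 2 (1 / 16) (1 / 50))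
    (hG : PeriodicBulkGapDoor 2) : VisibleGap (1 / 50) ∧ PertRegime (1 / 50) :=
  gap_and_pert_1_50_of_certs_16XH18_tol hL hL' hR hX hE hP hT hU h1 hGT hΛ0 hΛs hUc (untwistBookkeepingP_one 2 (1 / 50)) hl hN hF hE' hA
    hD hC (wildFractionPG_of_tilt_strain hKt hM) hG

/-- ★★★ **COLUMN `_16XH19` — the candidate of record with (R_W) cut and (Υb) discharged (ν := 1/2000; 23 leaves, no refuted leaf)**.  Open leaves: on
the (A0)-line as in `_16XH18`; on the (A1)/(R_W)-line now (K) [L, known-type] and (M) [L, idea-named]. [this file, g41] -/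
theorem gap_and_pert_1_50_of_certs_16XH19 (hL : LatticeLiouvilleCert) (hL' : LayeredLiouvilleCert)
    (hR : OscRigidityL2BDPG 1 2 (1 / 16) (1 / 16)) (hX : ExcessFlatnessControlP 1 2 (1 / 16) (1 / 16))
    (hE : ExcessChartLocalisationP 1 2 (1 / 16) (1 / 100)) (hP : RegistrationP 1 2 (1 / 16) (1 / 100))
    (hT : TailDominationCert) (hU : UniformTameStabilityE (1 / 50) 2 (1 / 2000))
    (h1 : WordTransplantP 1 2 (1 / 16) (1 / 100)) (hGT : GradReframingThickP 1 2 (1 / 16) (1 / 100) (1 / 50))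
    (hΛ0 : LaunderingAprioriPX 1 2 (1 / 16) (1 / 100) (1 / 50)) (hΛs : LaunderingStepPX 1 2 (1 / 16) (1 / 100) (1 / 50))
    (hUc : UntwistCollarP 1 2 (1 / 16) (1 / 50))
    (hl : BondIsoLevelsP 1 2 (1 / 16) (1 / 50)) (hN : EnergyNearChartPX 1 2 (1 / 16) (1 / 50) (1 / 2000))
    (hF : TailForceSlavingP 1 2 (1 / 16) (1 / 50))
    (hE' : LipDualLinearisationP 1 2 (1 / 16) (1 / 50)) (hA : L2HarmonicApproxPE 1 2 (1 / 16) (1 / 50) (1 / 2000))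
    (hD : PositionDecayPLE 1 2 (1 / 16) (1 / 50) (1 / 2000)) (hC : PositionCaccioppoliPGE 1 2 (1 / 16) (1 / 50) (1 / 2000))
    (hKt : TiltRigidityP 1 2 (1 / 16) (1 / 50)) (hM : StrainNonConcentrationPG 1 2 (1 / 16) (1 / 50))
    (hG : PeriodicBulkGapDoor 2) : VisibleGap (1 / 50) ∧ PertRegime (1 / 50) :=
  gap_and_pert_1_50_of_certs_16XH19_tol hL hL' hR hX hE hP hT hU h1 hGT hΛ0 hΛs hUc hl hN hF hE' hA hD hC hKt hM hG

end Summit.AtomisticToContinuum.Crystallization.Theorems.ChartedZeroExcessLayeredLatticeLiouville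

end
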